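/-
Origin: expansion seat `planner-pub-hodgecm-pv11-g4-0`, handover #4 2026-08-18T07:07:39Z (`HOME/pub-hodgecm-pv11-g4/lean/Pv11g4/NormOneRelTorusWeights.lean`, md5 18540a4d, 98 lines);
landed by the gen-7 packager in gate run 25 as `HodgeCM/PerL34/NormOneRelTorusWeights.lean` (import ^import Pv[0-9]+g[0-9]+\.→import HodgeCM.PerL34. ×1).
-/
/-
Origin: expansion seat `planner-pub-hodgecm-pv11-g4-0` (unit `pub-hodgecm-pv11-g4`, DAG-NODE PROVER #11 gen 4), HodgeCM publication
cell, 2026-08-18.  WIP module `Pv11g4.NormOneRelTorusWeights`; intended landing `HodgeCM/PerL34/NormOneRelTorusWeights.lean`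
(one import rewrite: `Pv11g4.NormOneRelTorusArch` ↦ `HodgeCM.PerL34.NormOneRelTorusArch`).
-/
import Summits.HodgeConjecture.HodgeCM.PerL34.NormOneRelTorusArch

/-!
# The weight characters of the archimedean torus `U(W_j)(L₀ ⊗ ℝ) ↪ ∏_w U(1)`

For a CM field `L` the archimedean torus `unitaryLineArchTorus L = {y ∈ L_∞^× : y ȳ = 1}` (file `NormOneRelTorusArch`)
has `‖y_w‖ = 1` at every infinite place `w`.  Composing with Mathlib's isometric embedding `L_w →+* ℂ`
(`InfinitePlace.Completion.extensionEmbedding w`) gives, for each `w`, a **continuous unitary character**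

* `NumberField.archPlaceChar L w : unitaryLineArchTorus L →* Circle`, `y ↦ ι_w(y_w)`,

and the joint map `y ↦ (ι_w(y_w))_w` is an injective continuous homomorphism
`NumberField.archPlaceChars L : unitaryLineArchTorus L →* (InfinitePlace L → Circle)` — the torus is a closed
(compact, by `compactSpace_unitaryLineArchTorus`) subgroup of the product of circles `∏_w U(1)`.  These are the characters
in which the weight `w : B → ℂ` of `φ_∞` (SETUP field of `SupplyBridgeA`; PerL §4.1, the two theta one-forms have weights
`t ↦ t_w^{±1}`) is expressed; the weight itself depends on `φ_∞` and stays SETUP data.  Pure construction; nothing cited.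
-/

set_option autoImplicit false

noncomputable section

open Topology Set Function

namespace NumberField

open IsDedekindDomain InfinitePlace
open Literature.NumberTheory Literature.NumberTheory.Automorphic

section Weights

variable (L : Type) [Field L] [NumberField L] [IsCMField L]

/-- `‖ι_w(y_w)‖ = 1` on the archimedean torus. -/
theorem norm_extensionEmbedding_apply_eq_one {y : (InfiniteAdeleRing L)ˣ} (hy : y ∈ unitaryLineArchTorus L)
    (w : InfinitePlace L) : ‖Completion.extensionEmbedding w ((y : InfiniteAdeleRing L) w)‖ = 1 := by
  rw [(Completion.isometry_extensionEmbedding w).norm_map_of_map_zero (map_zero _),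
    norm_apply_eq_one_of_mem_unitaryLineArchTorus L hy w]

/-- **The weight character at the place `w`**: `U(W_j)(L₀ ⊗ ℝ) → U(1)`, `y ↦ ι_w(y_w)`. -/
def archPlaceChar (w : InfinitePlace L) : unitaryLineArchTorus L →* Circle where
  toFun y := ⟨Completion.extensionEmbedding w (((y : (InfiniteAdeleRing L)ˣ) : InfiniteAdeleRing L) w),
    mem_sphere_zero_iff_norm.mpr (norm_extensionEmbedding_apply_eq_one L y.2 w)⟩
  map_one' := Circle.ext (by
    change Completion.extensionEmbedding w ((1 : InfiniteAdeleRing L) w) = 1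
    exact map_one _)
  map_mul' y z := Circle.ext (by
    change Completion.extensionEmbedding w (((y : (InfiniteAdeleRing L)ˣ) : InfiniteAdeleRing L) w *
        ((z : (InfiniteAdeleRing L)ˣ) : InfiniteAdeleRing L) w) = _
    rw [map_mul]; rfl)

/-- (Ported verbatim from the HodgeCMPerL package; no docstring in the source.) -/
@[simp] theorem coe_archPlaceChar (w : InfinitePlace L) (y : unitaryLineArchTorus L) :
    ((archPlaceChar L w y : Circle) : ℂ) =
      Completion.extensionEmbedding w (((y : (InfiniteAdeleRing L)ˣ) : InfiniteAdeleRing L) w) := rfl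

/-- The weight characters are continuous. -/
theorem continuous_archPlaceChar (w : InfinitePlace L) : Continuous (archPlaceChar L w) := by
  refine Continuous.subtype_mk ?_ _
  exact (Completion.isometry_extensionEmbedding w).continuous.comp
    ((continuous_apply w).comp (Units.continuous_val.comp continuous_subtype_val))

/-- The joint map `U(W_j)(L₀ ⊗ ℝ) → ∏_w U(1)`. -/
def archPlaceChars : unitaryLineArchTorus L →* (InfinitePlace L → Circle) :=
  MonoidHom.pi fun w => archPlaceChar L w

/-- (Ported verbatim from the HodgeCMPerL package; no docstring in the source.) -/
@[simp] theorem archPlaceChars_apply (y : unitaryLineArchTorus L) (w : InfinitePlace L) :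
    archPlaceChars L y w = archPlaceChar L w y := rfl

/-- (Ported verbatim from the HodgeCMPerL package; no docstring in the source.) -/
theorem continuous_archPlaceChars : Continuous (archPlaceChars L) :=
  continuous_pi fun w => continuous_archPlaceChar L w

/-- `U(W_j)(L₀ ⊗ ℝ) ↪ ∏_w U(1)`: an element of the archimedean torus is determined by its weight characters. -/
theorem archPlaceChars_injective : Function.Injective (archPlaceChars L) := by
  intro y z h
  apply Subtype.ext
  apply Units.ext
  funext w
  have hw := congrArg (fun f : InfinitePlace L → Circle => ((f w : Circle) : ℂ)) h
  simp only [archPlaceChars_apply, coe_archPlaceChar] at hw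
  exact (Completion.isometry_extensionEmbedding w).injective hw

/-- The image of the archimedean torus in `∏_w U(1)` is compact (hence closed). -/
theorem isCompact_range_archPlaceChars : IsCompact (Set.range (archPlaceChars L)) :=
  isCompact_range (continuous_archPlaceChars L)

/-- (Ported verbatim from the HodgeCMPerL package; no docstring in the source.) -/
theorem isClosed_range_archPlaceChars : IsClosed (Set.range (archPlaceChars L)) :=
  (isCompact_range_archPlaceChars L).isClosed

end Weights

end NumberField

end
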